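import Mathlib
import HarnessLib

/-!
# Reading an integrator's error off a step halving: in the one-term model `y(h) = y⋆ + K h^p` the difference `y(h) − y(h/2)` determines the error of both runs (`×2^p/(2^p−1)` and `×1/(2^p−1)`), and the Richardson combination is exact

HONEST FRAMING: exact (Metropolis-corrected) sampling algorithms for lattice gauge theory;
figures of merit are autocorrelation/cost numbers at stated couplings and volumes; no
continuum-physics claim.

Venture `LatticeQCDFlow` (cell pub-lqcd), sub-topic `Scoring`, FANOUT row 21 (`su3-base`).  The row's flow protocol checks its
RK3 integrator by a STEP HALVING: "at each point ONE configuration is re-flowed with (ε_fine, ε) halved; `|t₀(ε) − t₀(ε/2)|` is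
reported and must be `< 0.3 %` of `t₀` (else `ε` is halved for the point)" (HOME/su3-base/CARD-su3-base.md §3), against an
acceptance band of `3 %` on `t₀` (§7 (d)).  What does the halving difference `Δ = y(h) − y(h/2)` say about the actual error?
This file types the standard reading and its hypothesis — OUR WORK, Mathlib only, no definition, nothing cited as a fact, no
number of ours.  In the ONE-TERM ERROR MODEL `y(h) = y⋆ + K h^p` (order `p`; for Lüscher's RK3 `p = 3` globally):

* §1 `stepHalving_diff` (`Δ = K h^p (1 − 2^{−p})`), **`stepHalving_error_coarse`** (`y(h) − y⋆ = Δ · 2^p/(2^p − 1)`),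
  **`stepHalving_error_fine`** (`y(h/2) − y⋆ = Δ/(2^p − 1)`), **`richardson_exact`** (`(2^p y(h/2) − y(h))/(2^p − 1) = y⋆`:
  the Richardson combination removes the modelled error exactly).
* §2 `p = 3`: the factors are `8/7` and `1/7` (`stepHalving_factors_three`); with the card's tolerance `|Δ| ≤ δ·y⋆`
  (`δ = 3/1000`): **`stepHalving_rk3_coarse_le`** — `|y(h) − y⋆| ≤ (8/7)δ·|y⋆|` and **`stepHalving_rk3_fine_le`** —
  `|y(h/2) − y⋆| ≤ (1/7)δ·|y⋆|`; `(8/7)·(3/1000) < 35/10000` and `< 3/100` (`rk3_tolerance_arith`): inside the model a passed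
  halving test bounds the production-step error of `t₀` by `0.35 %`, an order of magnitude inside the `3 %` band.
* §3 MODEL-FREE DIRECTION (what does NOT need the model): if `|y(h) − y⋆| ≤ K h^p` and `|y(h/2) − y⋆| ≤ K (h/2)^p` then
  `|Δ| ≤ K h^p (1 + 2^{−p})` (`abs_stepHalving_diff_le`) — a small `Δ` is NECESSARY for a small error bound; the converse
  (inferring the error from `Δ`) is exactly the one-term model of §1 and is NOT claimed outside it.
NOT CLAIMED: that the RK3 flow error of `t₀` follows one term (pre-asymptotic `h`, the interpolation of `t₀` between steps —
row 21's `Scoring/FlowScaleInterpolation` — and round-off all add); any value of `K`, `t₀`.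
-/

namespace Summit.Ventures.LatticeQCDFlow.Scoring

/-! ## §1 The one-term model -/

section Model

variable {ystar K h : ℝ} {p : ℕ}

/-- `2^p − 1 > 0` for `p ≥ 1`. -/
theorem stepHalving_two_pow_sub_one_pos (hp : 1 ≤ p) : (0 : ℝ) < 2 ^ p - 1 := by
  have : (2 : ℝ) ≤ 2 ^ p := by
    calc (2 : ℝ) = 2 ^ 1 := by norm_num
      _ ≤ 2 ^ p := pow_le_pow_right₀ (by norm_num) hp
  linarith

/-- In the model `y(h) = y⋆ + K h^p`: `Δ = y(h) − y(h/2) = K h^p (1 − 2^{−p})`, written as `K h^p (2^p − 1)/2^p`. -/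
theorem stepHalving_diff (ystar K h : ℝ) (p : ℕ) :
    (ystar + K * h ^ p) - (ystar + K * (h / 2) ^ p) = K * h ^ p * (2 ^ p - 1) / 2 ^ p := by
  rw [div_pow]
  field_simp
  ring

/-- **The coarse run's error from the halving difference: `y(h) − y⋆ = Δ · 2^p/(2^p − 1)`** (`p ≥ 1`). -/
theorem stepHalving_error_coarse (hp : 1 ≤ p) (ystar K h : ℝ) :
    (ystar + K * h ^ p) - ystar =
      ((ystar + K * h ^ p) - (ystar + K * (h / 2) ^ p)) * 2 ^ p / (2 ^ p - 1) := by
  have h1 := stepHalving_two_pow_sub_one_pos hp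
  rw [stepHalving_diff]
  field_simp
  ring

/-- **The fine run's error from the halving difference: `y(h/2) − y⋆ = Δ/(2^p − 1)`** (`p ≥ 1`). -/
theorem stepHalving_error_fine (hp : 1 ≤ p) (ystar K h : ℝ) :
    (ystar + K * (h / 2) ^ p) - ystar =
      ((ystar + K * h ^ p) - (ystar + K * (h / 2) ^ p)) / (2 ^ p - 1) := by
  have h1 := stepHalving_two_pow_sub_one_pos hp
  rw [stepHalving_diff, div_pow]
  field_simp
  ring

/-- **Richardson extrapolation is exact in the model: `(2^p y(h/2) − y(h))/(2^p − 1) = y⋆`** (`p ≥ 1`). -/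
theorem richardson_exact (hp : 1 ≤ p) (ystar K h : ℝ) :
    (2 ^ p * (ystar + K * (h / 2) ^ p) - (ystar + K * h ^ p)) / (2 ^ p - 1) = ystar := by
  have h1 := stepHalving_two_pow_sub_one_pos hp
  rw [div_pow]
  field_simp
  ring

end Model

/-! ## §2 Third order: the factors `8/7` and `1/7`, and the card's tolerance -/

/-- At `p = 3`: `2^p/(2^p − 1) = 8/7` and `1/(2^p − 1) = 1/7`. -/
theorem stepHalving_factors_three : (2 : ℝ) ^ 3 / (2 ^ 3 - 1) = 8 / 7 ∧ (1 : ℝ) / (2 ^ 3 - 1) = 1 / 7 := by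
  constructor <;> norm_num

/-- **RK3, coarse step: a passed halving test `|Δ| ≤ δ|y⋆|` gives `|y(h) − y⋆| ≤ (8/7)δ|y⋆|`** in the one-term model. -/
theorem stepHalving_rk3_coarse_le {ystar K h δ : ℝ}
    (hΔ : |(ystar + K * h ^ 3) - (ystar + K * (h / 2) ^ 3)| ≤ δ * |ystar|) :
    |(ystar + K * h ^ 3) - ystar| ≤ 8 / 7 * δ * |ystar| := by
  rw [stepHalving_error_coarse (p := 3) (by norm_num) ystar K h, abs_div, abs_mul]
  have h7 : |(2 : ℝ) ^ 3 - 1| = 7 := by norm_num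
  have h8 : |(2 : ℝ) ^ 3| = 8 := by norm_num
  rw [h7, h8]
  have := mul_le_mul_of_nonneg_right hΔ (by norm_num : (0 : ℝ) ≤ 8)
  calc |ystar + K * h ^ 3 - (ystar + K * (h / 2) ^ 3)| * 8 / 7 ≤ δ * |ystar| * 8 / 7 := by
        exact div_le_div_of_nonneg_right this (by norm_num)
    _ = 8 / 7 * δ * |ystar| := by ring

/-- **RK3, fine step: `|y(h/2) − y⋆| ≤ (1/7)δ|y⋆|`** under the same passed test, in the one-term model. -/
theorem stepHalving_rk3_fine_le {ystar K h δ : ℝ}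
    (hΔ : |(ystar + K * h ^ 3) - (ystar + K * (h / 2) ^ 3)| ≤ δ * |ystar|) :
    |(ystar + K * (h / 2) ^ 3) - ystar| ≤ 1 / 7 * δ * |ystar| := by
  rw [stepHalving_error_fine (p := 3) (by norm_num) ystar K h, abs_div]
  have h7 : |(2 : ℝ) ^ 3 - 1| = 7 := by norm_num
  rw [h7]
  calc |ystar + K * h ^ 3 - (ystar + K * (h / 2) ^ 3)| / 7 ≤ δ * |ystar| / 7 :=
        div_le_div_of_nonneg_right hΔ (by norm_num)
    _ = 1 / 7 * δ * |ystar| := by ring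

/-- The card's tolerance in arithmetic: `δ = 3/1000` gives `(8/7)δ < 35/10000` (i.e. `< 0.35 %`), far inside `3/100`, and
`(1/7)δ < 5/10000`. -/
theorem rk3_tolerance_arith :
    (8 : ℝ) / 7 * (3 / 1000) < 35 / 10000 ∧ (8 : ℝ) / 7 * (3 / 1000) < 3 / 100 ∧ (1 : ℝ) / 7 * (3 / 1000) < 5 / 10000 := by
  refine ⟨by norm_num, by norm_num, by norm_num⟩

/-! ## §3 The model-free direction -/

/-- **Small errors force a small halving difference** (no model): if `|y₁ − y⋆| ≤ K h^p` and `|y₂ − y⋆| ≤ K (h/2)^p` then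
`|y₁ − y₂| ≤ K h^p (1 + (1/2)^p)`.  (The converse inference is the one-term model of §1.) -/
theorem abs_stepHalving_diff_le {y₁ y₂ ystar K h : ℝ} {p : ℕ} (h1 : |y₁ - ystar| ≤ K * h ^ p)
    (h2 : |y₂ - ystar| ≤ K * (h / 2) ^ p) : |y₁ - y₂| ≤ K * h ^ p * (1 + (1 / 2) ^ p) := by
  have e : y₁ - y₂ = (y₁ - ystar) - (y₂ - ystar) := by ring
  rw [e]
  calc |(y₁ - ystar) - (y₂ - ystar)| ≤ |y₁ - ystar| + |y₂ - ystar| := abs_sub _ _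
    _ ≤ K * h ^ p + K * (h / 2) ^ p := add_le_add h1 h2
    _ = K * h ^ p * (1 + (1 / 2) ^ p) := by rw [div_pow, div_eq_mul_one_div (h ^ p), one_div_pow]; ring

end Summit.Ventures.LatticeQCDFlow.Scoring
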